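import Mathlib.LinearAlgebra.Dual.Lemmas
import Mathlib.LinearAlgebra.FiniteDimensional.Lemmas
import HarnessLib

/-!
# Roy 1995, Theorem 3.4 — linear-algebra lemmas for the proof

`Literature/Barriers/Schanuel/LinearSubgroupMethodLimitLemmas.lean` — support file for the
coordinate-free abstract form `Roy1995.finrank_add_finrank_le` of Roy's Theorem 3.4 (the named
fact `Literature.Barriers.Schanuel.roy1995_thm_3_4` = `LinearSubgroupMethodLimit` of
`Literature/Barriers/Schanuel/LinearSubgroupMethodLimit.lean`); the passage to the quotient, the
induction and the specialisation to the matrix statement (an `example`) are in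
`Literature/Barriers/Schanuel/LinearSubgroupMethodLimitInduction.lean`.  The named fact itself is
DISCHARGED by `roy1995_thm_3_4_holds` / `linearSubgroupMethodLimit_holds` of
`Literature/Barriers/Schanuel/LinearSubgroupMethodLimitProofs.lean` (an independent proof by
realisation of coefficient triples); the two developments share no declarations.

## The printed proof [Roy1995, p. 66] and its Lean rendering

Roy's proof of Theorem 3.4 runs in `K^l` with its rational structure: `E` = the `ℚ`-span of the
rows, `U` = the smallest `ℚ`-defined subspace containing a suitably minimal `u₁ ∈ E`, the count
`d₁ + l₁ ≤ 4 r₁` for `E ∩ U`, and an induction on the rank through the block decomposition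
`PMQ = (M₁ 0; M₃ M₂)`, i.e. through the quotient `K^l / U`.  To run the induction without
re-coordinatising we replace "`K^l` with its rational linear forms" by an abstract datum:
a finite-dimensional `K`-space `W` (`K` an `F`-algebra, `F` playing `ℚ`) with a
*parametrisation of its rational forms*, an `F`-linear map `Ψ : V →ₗ[F] Module.Dual K W` from a
finite-dimensional `F`-space `V` such that

* `F`-linearly independent families `c` in `V` give `K`-linearly independent forms `Ψ ∘ c`, and
* `finrank K W ≤ finrank F V`

(for `W = K^l`: `V = F^l`, `Ψ c = ∑ c_j pr_j`).  "Entries in `L₀`" becomes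
`∀ a, Ψ a (E) ⊆ L₀`, "columns `ℚ`-linearly independent" becomes "no non-zero `a` has `Ψ a`
killing `E`", and the datum passes to `W ⧸ U` with `V_U = Ψ⁻¹(ann U)` and
`Ψ' a = (Ψ a) factored through the quotient` (lemmas `quot_*`, Induction file).  The only
arithmetic input is the *multiplier property* of `L₀ = ⟨λ₁, λ₂, λ₃⟩_ℚ` ("since `λ₁, λ₂, λ₃` are
linearly independent over `ℚ̄` …"): `t L₀ ⊆ L₀ ⇒ t ∈ ℚ`, proved in the statement file as
`exists_eq_ratCast_of_mul_mem_span`; here it is the hypothesis `hrig`.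

This file: base change of linear independence from `F^ι` to `K^ι`
(`linearIndependent_algebraMap_pi`), the trichotomy "dim `{t : t L₁ ⊆ L₀}` is `1 / ≤ 2 / ≤ 3`
for `dim L₁ = 3 / 2 / 1`" (`finrank_multipliers_add_finrank_le_four`), the dimension count for
rational forms, and Roy's local step `d₁ + l₁ ≤ 4 r₁` (`local_step`); the passage to the
quotient, the induction and the matrix statement are in the Induction file.  Everything is
proved; there are no new definitions.

## References

* [Roy1995] D. Roy, *Points whose coordinates are logarithms of algebraic numbers on algebraic
  varieties*, Acta Math. 175 (1995) 49–73, §3.2, Theorem 3.4 and its proof, p. 66.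
-/

noncomputable section

open Module Submodule

namespace Literature.Barriers.Schanuel.Roy1995

universe u

variable {F K : Type*} [Field F] [Field K] [Algebra F K]

/-! ### Base change of linear independence -/

/-- Vectors of `F^ι` which are linearly independent over `F` stay linearly independent over any
field extension `K` of `F` (proof: apply every `F`-linear functional `K → F` to a `K`-linear
relation). [folklore] -/
theorem linearIndependent_algebraMap_pi {ι : Type*} [Fintype ι] {n : ℕ} {v : Fin n → ι → F}
    (hv : LinearIndependent F v) :
    LinearIndependent K (fun i j => algebraMap F K (v i j)) := by
  rw [Fintype.linearIndependent_iff] at hv ⊢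
  intro g hg i
  rw [← Module.forall_dual_apply_eq_zero_iff F (g i)]
  intro f
  refine hv (fun i => f (g i)) ?_ i
  funext j
  have hj := congrFun hg j
  simp only [Finset.sum_apply, Pi.smul_apply, smul_eq_mul, Pi.zero_apply] at hj ⊢
  have h2 : f (∑ i, g i * algebraMap F K (v i j)) = 0 := by rw [hj, map_zero]
  rw [map_sum] at h2
  rw [← h2]
  refine Finset.sum_congr rfl fun k _ => ?_
  rw [mul_comm (g k), ← Algebra.smul_def, LinearMap.map_smul, smul_eq_mul, mul_comm]

/-! ### The multiplier trichotomy -/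

/-- **Roy's trichotomy.** Let `L₁ ≤ L₀` be `F`-subspaces of `K` with `dim_F L₀ ≤ 3`, `L₁ ≠ 0`,
and assume the multiplier property `t L₀ ⊆ L₀ ⇒ t ∈ F`.  If every element of an `F`-subspace
`T` multiplies `L₁` into `L₀`, then `T` is finite-dimensional and `dim_F T + dim_F L₁ ≤ 4`
("the dimension over `ℚ` of the set of all `t ∈ K` such that `tL₁ ⊆ L₀` is `1` if `l₁ = 3`,
`≤ 2` if `l₁ = 2` and `≤ 3` if `l₁ = 1`"). [cite: Roy1995, §3.2 proof of Theorem 3.4] -/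
theorem finrank_multipliers_add_finrank_le_four (L₀ L₁ T : Submodule F K) [Module.Finite F L₀]
    (h3 : finrank F L₀ ≤ 3)
    (hrig : ∀ t : K, (∀ x ∈ L₀, t * x ∈ L₀) → ∃ c : F, t = algebraMap F K c)
    (h10 : L₁ ≤ L₀) (h1 : L₁ ≠ ⊥) (hT : ∀ t ∈ T, ∀ x ∈ L₁, t * x ∈ L₀) :
    Module.Finite F T ∧ finrank F T + finrank F L₁ ≤ 4 := by
  obtain ⟨x₀, hx₀L, hx₀⟩ := (Submodule.ne_bot_iff L₁).mp h1
  -- `T ⊆ x⁻¹ L₀` for every non-zero `x ∈ L₁`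
  have hTle : ∀ x ∈ L₁, x ≠ 0 → T ≤ L₀.map (LinearMap.mulRight F x⁻¹) := by
    intro x hxL hx t ht
    refine Submodule.mem_map.mpr ⟨t * x, hT t ht x hxL, ?_⟩
    simp [LinearMap.mulRight_apply, mul_assoc, mul_inv_cancel₀ hx]
  have hfinx : ∀ x : K, finrank F (L₀.map (LinearMap.mulRight F x⁻¹)) ≤ 3 := fun x =>
    (Submodule.finrank_map_le _ _).trans h3
  haveI hTfin : Module.Finite F T := Submodule.finiteDimensional_of_le (hTle x₀ hx₀L hx₀)
  have hT3 : finrank F T ≤ 3 := (Submodule.finrank_mono (hTle x₀ hx₀L hx₀)).trans (hfinx x₀)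
  haveI : Module.Finite F L₁ := Submodule.finiteDimensional_of_le h10
  have hm3 : finrank F L₁ ≤ 3 := (Submodule.finrank_mono h10).trans h3
  refine ⟨hTfin, ?_⟩
  rcases Nat.lt_or_ge (finrank F L₁) 2 with hm | hm
  · omega
  rcases Nat.lt_or_ge (finrank F L₁) 3 with hm' | hm'
  · -- `dim L₁ = 2`: `dim T ≤ 2`
    suffices hT2 : finrank F T ≤ 2 by omega
    by_contra hcon
    push Not at hcon
    have hTeq : T = L₀.map (LinearMap.mulRight F x₀⁻¹) :=
      Submodule.eq_of_le_of_finrank_le (hTle x₀ hx₀L hx₀) ((hfinx x₀).trans hcon)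
    have hlt : (F ∙ x₀) < L₁ := by
      refine lt_of_le_of_ne ((Submodule.span_singleton_le_iff_mem x₀ L₁).mpr hx₀L) ?_
      intro heq
      have h1' := finrank_span_singleton (K := F) hx₀
      rw [heq] at h1'
      omega
    obtain ⟨x₂, hx₂L, hx₂⟩ := SetLike.exists_of_lt hlt
    have hs : ∀ y ∈ L₀, (x₂ * x₀⁻¹) * y ∈ L₀ := by
      intro y hy
      have hy' : y * x₀⁻¹ ∈ T := by
        rw [hTeq]
        exact Submodule.mem_map.mpr ⟨y, hy, rfl⟩
      have := hT _ hy' x₂ hx₂L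
      convert this using 1
      ring
    obtain ⟨c, hc⟩ := hrig _ hs
    apply hx₂
    rw [Submodule.mem_span_singleton]
    refine ⟨c, ?_⟩
    rw [← algebraMap_smul K c x₀, ← hc, smul_eq_mul, mul_assoc, inv_mul_cancel₀ hx₀, mul_one]
  · -- `dim L₁ = 3`: `L₁ = L₀` and `T ⊆ F · 1`
    have hL : L₁ = L₀ := Submodule.eq_of_le_of_finrank_le h10 (h3.trans hm')
    have hT1 : T ≤ F ∙ (1 : K) := by
      intro t ht
      obtain ⟨c, hc⟩ := hrig t (fun x hx => hT t ht x (hL ▸ hx))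
      rw [Submodule.mem_span_singleton]
      exact ⟨c, by rw [hc, Algebra.algebraMap_eq_smul_one]⟩
    have : finrank F T ≤ 1 :=
      (Submodule.finrank_mono hT1).trans (finrank_span_singleton (K := F) (one_ne_zero (α := K))).le
    omega

/-! ### Parametrised rational forms: dimension count and separation -/

variable {W : Type u} [AddCommGroup W] [Module K W]
variable {V : Type*} [AddCommGroup V] [Module F V]

/-- If `F`-independent families `c` in `V` give `K`-independent forms `Ψ ∘ c`, then for every
finite-dimensional `F`-subspace `A ≤ V` the `K`-span of `Ψ(A)` has `K`-dimension `dim_F A`.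
[folklore] -/
theorem finrank_span_image_eq [FiniteDimensional K W] (Ψ : V →ₗ[F] Module.Dual K W)
    (hΨ : ∀ (n : ℕ) (c : Fin n → V), LinearIndependent F c →
      LinearIndependent K (fun i => Ψ (c i)))
    (A : Submodule F V) [Module.Finite F A] :
    finrank K (span K (Ψ '' (A : Set V))) = finrank F A := by
  obtain ⟨b⟩ : Nonempty (Basis (Fin (finrank F A)) F A) := ⟨Module.finBasis F A⟩
  have hcF : LinearIndependent F (A.subtype ∘ b) :=
    b.linearIndependent.map' A.subtype (Submodule.ker_subtype A)
  have hvK : LinearIndependent K (fun i => Ψ ((A.subtype ∘ b) i)) := hΨ _ _ hcF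
  have hspan : span K (Ψ '' (A : Set V)) = span K (Set.range fun i => Ψ ((A.subtype ∘ b) i)) := by
    apply le_antisymm
    · rw [Submodule.span_le]
      rintro _ ⟨a, ha, rfl⟩
      have hrepr : (⟨a, ha⟩ : A) = ∑ i, b.repr ⟨a, ha⟩ i • b i := (b.sum_repr _).symm
      have haeq : a = ∑ i, b.repr ⟨a, ha⟩ i • (A.subtype ∘ b) i := by
        have := congrArg (fun x : A => (x : V)) hrepr
        simp only [Submodule.coe_sum, Submodule.coe_smul, Function.comp_apply,
          Submodule.coe_subtype] at this ⊢
        exact this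
      rw [haeq, map_sum]
      refine Submodule.sum_mem _ fun i _ => ?_
      rw [LinearMap.map_smul, ← algebraMap_smul K (b.repr ⟨a, ha⟩ i)]
      exact Submodule.smul_mem _ _ (Submodule.subset_span ⟨i, rfl⟩)
    · refine Submodule.span_mono ?_
      rintro _ ⟨i, rfl⟩
      exact ⟨_, (b i).2, rfl⟩
  rw [hspan, finrank_span_eq_card hvK, Fintype.card_fin]

/-- Rational forms separate points: under the two axioms (`F`-independent ⇒ `K`-independent,
`dim_K W ≤ dim_F V`) the forms `Ψ(V)` span `Module.Dual K W` over `K`, so a vector killed by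
all of them is zero. [folklore] -/
theorem eq_zero_of_forall_apply_eq_zero [FiniteDimensional K W] [Module.Finite F V]
    (Ψ : V →ₗ[F] Module.Dual K W)
    (hΨ : ∀ (n : ℕ) (c : Fin n → V), LinearIndependent F c →
      LinearIndependent K (fun i => Ψ (c i)))
    (hdim : finrank K W ≤ finrank F V) {w : W} (hw : ∀ a, Ψ a w = 0) : w = 0 := by
  have hfr := finrank_span_image_eq Ψ hΨ ⊤
  rw [finrank_top, Submodule.top_coe, Set.image_univ] at hfr
  have htop : span K (Set.range Ψ) = ⊤ := by
    apply Submodule.eq_top_of_finrank_eq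
    apply le_antisymm (Submodule.finrank_le _)
    rw [hfr, Subspace.dual_finrank_eq]
    exact hdim
  rw [← Module.forall_dual_apply_eq_zero_iff K w]
  intro φ
  have hφ : φ ∈ span K (Set.range Ψ) := by rw [htop]; exact Submodule.mem_top
  have hle : span K (Set.range Ψ) ≤ LinearMap.ker (Module.Dual.eval K W w) := by
    rw [Submodule.span_le]
    rintro _ ⟨a, rfl⟩
    simpa using hw a
  simpa using hle hφ

/-! ### Roy's local step: `d₁ + l₁ ≤ 4 r₁` -/

/-- **The local step of Roy's proof of Theorem 3.4.** In the abstract setting (module docstring):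
if `E ≠ 0` there are a `K`-subspace `U` of `W` ("the smallest subspace of `K^l` defined over `ℚ`
containing `u₁`", `u₁ ∈ E` chosen with `dim U` minimal) and an `F`-subspace `A` of `V` (the
rational forms vanishing at `u₁`; `U` is their common kernel, `dim_K W = dim_F A + dim_K U`) such
that `E₁ = E ∩ U` has `r₁ = dim_K ⟨E₁⟩_K ≥ 1` and `d₁ + l₁ ≤ 4 r₁` (`d₁ = dim_F E₁`,
`l₁ = dim_K U`): "`l₁ ≤ 3` … `d₁ ≤ 3`, thus `d₁ + l₁ ≤ 4r₁` in the case `r₁ ≥ 2`. Assume `r₁ = 1`.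
Then, each element of `E ∩ U` is of the form `t u₁` where `t L₁ ⊆ L₀` … This implies
`d₁ + l₁ ≤ 4` in all cases." [cite: Roy1995, §3.2 proof of Theorem 3.4] -/
theorem local_step [FiniteDimensional K W] [Module F W] [IsScalarTower F K W]
    (L₀ : Submodule F K) [Module.Finite F L₀] (h3 : finrank F L₀ ≤ 3)
    (hrig : ∀ t : K, (∀ x ∈ L₀, t * x ∈ L₀) → ∃ c : F, t = algebraMap F K c)
    [Module.Finite F V] (Ψ : V →ₗ[F] Module.Dual K W)
    (hΨ : ∀ (n : ℕ) (c : Fin n → V), LinearIndependent F c →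
      LinearIndependent K (fun i => Ψ (c i)))
    (hdim : finrank K W ≤ finrank F V)
    (E : Submodule F W) [Module.Finite F E] (hE : ∀ a, ∀ e ∈ E, Ψ a e ∈ L₀) (hE0 : E ≠ ⊥) :
    ∃ (U : Submodule K W) (A : Submodule F V), (∀ a ∈ A, ∀ w ∈ U, Ψ a w = 0) ∧
      finrank K W ≤ finrank F A + finrank K U ∧
      0 < finrank K (span K ((E ⊓ U.restrictScalars F : Submodule F W) : Set W)) ∧
      finrank F ↥(E ⊓ U.restrictScalars F) + finrank K U ≤
        4 * finrank K (span K ((E ⊓ U.restrictScalars F : Submodule F W) : Set W)) := by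
  classical
  -- the rational forms vanishing at `u`, as a subspace of `V`
  let ev : W → (V →ₗ[F] K) := fun u => ((Module.Dual.eval K W u).restrictScalars F) ∘ₗ Ψ
  have hev : ∀ u a, ev u a = Ψ a u := fun u a => rfl
  let A : W → Submodule F V := fun u => LinearMap.ker (ev u)
  have hAmem : ∀ u a, a ∈ A u ↔ Ψ a u = 0 := fun u a => by
    simp only [A, LinearMap.mem_ker, hev]
  -- choose `u₁ ∈ E ∖ 0` maximising `dim_F (A u)` (= minimising `dim U(u)`)
  let s : Set ℕ := {n | ∃ u ∈ E, u ≠ 0 ∧ finrank F (A u) = n}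
  obtain ⟨u₀, hu₀E, hu₀⟩ := (Submodule.ne_bot_iff E).mp hE0
  have hsne : s.Nonempty := ⟨_, u₀, hu₀E, hu₀, rfl⟩
  have hsbdd : BddAbove s := ⟨finrank F V, by
    rintro _ ⟨u, -, -, rfl⟩
    exact Submodule.finrank_le _⟩
  obtain ⟨u₁, hu₁E, hu₁0, hu₁s⟩ := Nat.sSup_mem hsne hsbdd
  have hmax : ∀ u ∈ E, u ≠ 0 → finrank F (A u) ≤ finrank F (A u₁) := fun u hu hu0 => by
    rw [hu₁s]
    exact le_csSup hsbdd ⟨u, hu, hu0, rfl⟩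
  -- `U` := the common kernel of the forms in `Ψ (A u₁)`
  let U : Submodule K W := (span K (Ψ '' (A u₁ : Set V))).dualCoannihilator
  have hUmem : ∀ w, w ∈ U ↔ ∀ a ∈ A u₁, Ψ a w = 0 := by
    intro w
    rw [Submodule.mem_dualCoannihilator]
    constructor
    · intro h a ha
      exact h _ (Submodule.subset_span ⟨a, ha, rfl⟩)
    · intro h φ hφ
      have hle : span K (Ψ '' (A u₁ : Set V)) ≤ LinearMap.ker (Module.Dual.eval K W w) := by
        rw [Submodule.span_le]
        rintro _ ⟨a, ha, rfl⟩
        simpa using h a ha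
      simpa using hle hφ
  have hu₁U : u₁ ∈ U := (hUmem u₁).mpr fun a ha => (hAmem u₁ a).mp ha
  have hdimU : finrank K (span K (Ψ '' (A u₁ : Set V))) + finrank K U = finrank K W :=
    Subspace.finrank_add_finrank_dualCoannihilator_eq _
  have hspanA : finrank K (span K (Ψ '' (A u₁ : Set V))) = finrank F (A u₁) :=
    finrank_span_image_eq Ψ hΨ (A u₁)
  refine ⟨U, A u₁, fun a ha w hw => (hUmem w).mp hw a ha, by omega, ?_⟩
  -- `L₁` := the values `Ψ a u₁`; rank–nullity `dim L₁ + dim (A u₁) = dim V`, so `dim U ≤ dim L₁`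
  let L₁ : Submodule F K := LinearMap.range (ev u₁)
  have hL₁le : L₁ ≤ L₀ := by
    rintro _ ⟨a, rfl⟩
    exact hE a u₁ hu₁E
  have hrn : finrank F L₁ + finrank F (A u₁) = finrank F V :=
    LinearMap.finrank_range_add_finrank_ker (ev u₁)
  have hUm : finrank K U ≤ finrank F L₁ := by omega
  have hm3 : finrank F L₁ ≤ 3 := (Submodule.finrank_mono hL₁le).trans h3
  -- a rational form not vanishing at `u₁`
  obtain ⟨a₀, ha₀⟩ : ∃ a₀, Ψ a₀ u₁ ≠ 0 := by
    by_contra h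
    push Not at h
    exact hu₁0 (eq_zero_of_forall_apply_eq_zero Ψ hΨ hdim h)
  have hL₁0 : L₁ ≠ ⊥ := by
    intro h
    have : ev u₁ a₀ ∈ L₁ := LinearMap.mem_range_self _ _
    rw [h, Submodule.mem_bot] at this
    exact ha₀ this
  -- `E₁ = E ∩ U`; by maximality `Ψ a₀` is injective on `E₁`, so `d₁ ≤ 3`
  set E₁ : Submodule F W := E ⊓ U.restrictScalars F with hE₁
  have hE₁E : E₁ ≤ E := inf_le_left
  have hE₁U : ∀ e ∈ E₁, e ∈ U := fun e he => he.2
  have hu₁E₁ : u₁ ∈ E₁ := ⟨hu₁E, hu₁U⟩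
  have hinj : ∀ e ∈ E₁, Ψ a₀ e = 0 → e = 0 := by
    intro e he hae
    by_contra hne
    have hlt : A u₁ < A e := by
      refine lt_of_le_of_ne ?_ ?_
      · intro a ha
        exact (hAmem e a).mpr ((hUmem e).mp (hE₁U e he) a ha)
      · intro heq
        have : a₀ ∈ A e := (hAmem e a₀).mpr hae
        rw [← heq, hAmem] at this
        exact ha₀ this
    exact absurd (hmax e (hE₁E he) hne) (not_le.mpr (Submodule.finrank_lt_finrank_of_lt hlt))
  have hd3 : finrank F E₁ ≤ 3 := by
    let f : E₁ →ₗ[F] K := ((Ψ a₀).restrictScalars F).domRestrict E₁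
    have hf : Function.Injective f := by
      rw [← LinearMap.ker_eq_bot, LinearMap.ker_eq_bot']
      intro e he
      exact Subtype.ext (hinj e e.2 he)
    have hrange : LinearMap.range f ≤ L₀ := by
      rintro _ ⟨e, rfl⟩
      exact hE a₀ e (hE₁E e.2)
    calc finrank F E₁ = finrank F (LinearMap.range f) := (LinearMap.finrank_range_of_inj hf).symm
      _ ≤ finrank F L₀ := Submodule.finrank_mono hrange
      _ ≤ 3 := h3
  -- `r₁ ≥ 1`
  have hKu₁ : (K ∙ u₁) ≤ span K (E₁ : Set W) :=
    (Submodule.span_singleton_le_iff_mem u₁ _).mpr (Submodule.subset_span hu₁E₁)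
  have hr1 : 1 ≤ finrank K (span K (E₁ : Set W)) := by
    have := Submodule.finrank_mono hKu₁
    rwa [finrank_span_singleton hu₁0] at this
  refine ⟨hr1, ?_⟩
  by_cases hr : finrank K (span K (E₁ : Set W)) = 1
  · -- `r₁ = 1`: `E₁ ⊆ {t u₁ : t L₁ ⊆ L₀}` and the trichotomy
    have hS₁eq : (K ∙ u₁) = span K (E₁ : Set W) :=
      Submodule.eq_of_le_of_finrank_eq hKu₁ (by rw [finrank_span_singleton hu₁0, hr])
    let g : K →ₗ[F] W := (LinearMap.toSpanSingleton K W u₁).restrictScalars F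
    have hg : ∀ t, g t = t • u₁ := fun t => rfl
    let T : Submodule F K := E₁.comap g
    have hTmul : ∀ t ∈ T, ∀ x ∈ L₁, t * x ∈ L₀ := by
      rintro t ht _ ⟨a, rfl⟩
      have h1 : Ψ a (t • u₁) ∈ L₀ := hE a _ (hE₁E ht)
      rwa [map_smul, smul_eq_mul] at h1
    obtain ⟨hTfin, hT4⟩ :=
      finrank_multipliers_add_finrank_le_four L₀ L₁ T h3 hrig hL₁le hL₁0 hTmul
    have hE₁T : E₁ ≤ T.map g := by
      intro e he
      have : e ∈ K ∙ u₁ := by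
        rw [hS₁eq]
        exact Submodule.subset_span he
      obtain ⟨t, rfl⟩ := Submodule.mem_span_singleton.mp this
      exact ⟨t, he, rfl⟩
    have hd₁T : finrank F E₁ ≤ finrank F T :=
      (Submodule.finrank_mono hE₁T).trans (Submodule.finrank_map_le g T)
    rw [hr]
    omega
  · omega

end Literature.Barriers.Schanuel.Roy1995
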